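import Summits.NavierStokesRegularity.NavierStokesRegularity.Theses.HubbleDynamo
import Summits.NavierStokesRegularity.NavierStokesRegularity.Theorems.HubbleDynamoDynamoKillsTypeIZoom
import HarnessLib

/-!
# Route HubbleDynamo — `DynamoKillsTypeI` (item stmt-NavierStokesRegularity-1936)

The zoom glue of route HubbleDynamo: `NoSelfExcitedDynamo → FarFieldSlaving →` no Type-I blow-up
for finite-energy classical solutions of Navier–Stokes from rapidly decaying data (conclusion
`HasSmoothExtensionPast ν 0 u T`). Proof (Koch–Nadirashvili–Seregin–Šverák 2009, §6, run in the
POINTWISE Type-I class): if `u` did not extend past `T`, normalise the viscosity to `1` keeping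
the Type-I rate (`typeIZoom_unit_viscosity`); the hypothesis `FarFieldSlaving` (valid at every
viscosity, applied to the normalised solution) makes every point a space–time Type-I centre; the
zoom `hubbleDynamo_zoom_unit` (helper 2: Leray points with a convergent centre `x_k → x*`, zoom
centred at `x*` with Leray's vertex shift, compactness `typeIZoom_compactness`, limit step
`hubbleDynamo_zoom_limit`) produces a bounded ancient mild solution (`ν = 1`) with measurable
slices and pointwise Type-I decay `HasTypeIDecay C'` having a slice which is not a.e. zero —
which the hypothesis `NoSelfExcitedDynamo` forbids. Unconditional: no named fact is taken as a
hypothesis (the far-field bound, the Kato-class membership, Leray's lower rate, the Oseen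
representation and the compactness are theorems of the tree).
-/

noncomputable section

namespace Summit.NavierStokesRegularity.NavierStokesRegularity.Theorems

open MeasureTheory Set Filter Topology Function Metric
open scoped RealInnerProductSpace NNReal ENNReal
open Literature.Analysis Literature.Analysis.FluidPDE

/-- **`DynamoKillsTypeI`** (item stmt-NavierStokesRegularity-1936, route HubbleDynamo): the zoom
glue — `NoSelfExcitedDynamo → FarFieldSlaving →` no Type-I blow-up (conclusion
`HasSmoothExtensionPast`) for finite-energy classical solutions from rapidly decaying data.
Proof (KNSS 2009, §6, in the pointwise class): if `u` did not extend, normalise the viscosity to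
`1` keeping the Type-I rate (`typeIZoom_unit_viscosity`, `v(s, x) = ν⁻¹u(s/ν, x)` on `[0, νT)`);
`FarFieldSlaving` (the second hypothesis, valid at every viscosity) makes every point a space–time
Type-I centre of `v`; the zoom `hubbleDynamo_zoom_unit` then yields a bounded ancient mild
solution with measurable slices and pointwise Type-I decay having a slice which is not a.e.
zero — contradicting `NoSelfExcitedDynamo` (the first hypothesis).
[cite: KochNadirashviliSereginSverak2009, §6 proof of Thm 6.2 (arXiv:0709.3599 pp. 11–13)] -/
theorem hubbleDynamo_dynamoKillsTypeI_proof :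
    Summit.NavierStokesRegularity.NavierStokesRegularity.Theses.HubbleDynamo.DynamoKillsTypeI := by
  unfold Summit.NavierStokesRegularity.NavierStokesRegularity.Theses.HubbleDynamo.DynamoKillsTypeI
  intro h₁ h₂ ν T hν hT u p hcl hLH hdec hTI
  by_contra hext
  obtain ⟨C₀, hC₀⟩ := hTI
  have hsν : 0 < Real.sqrt ν := Real.sqrt_pos.2 hν
  set C : ℝ := max C₀ 1 / Real.sqrt ν with hCdef
  have hC : 0 < C := div_pos (lt_of_lt_of_le one_pos (le_max_right _ _)) hsν
  -- the rate in the form `√(T − t)‖u‖ ≤ C√ν`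
  have hrate : ∀ᶠ t in 𝓝[<] T, ∀ x, Real.sqrt (T - t) * ‖u t x‖ ≤ C * Real.sqrt ν := by
    filter_upwards [hC₀, self_mem_nhdsWithin] with t ht htT x
    have htT' : t < T := htT
    have hs : 0 < Real.sqrt (T - t) := Real.sqrt_pos.2 (sub_pos.2 htT')
    have h := ht x
    rw [le_div_iff₀ hs] at h
    have e : C * Real.sqrt ν = max C₀ 1 := by rw [hCdef]; field_simp
    rw [e, mul_comm]
    exact h.trans (le_max_left _ _)
  -- normalise `ν = 1`
  obtain ⟨v, π, hclv, hLHv, hdecv, hratev, hextv⟩ :=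
    typeIZoom_unit_viscosity C ν T u p hν hT hcl hLH hdec hrate hext
  have hνT : 0 < ν * T := mul_pos hν hT
  have hTIv : IsTypeIBlowup v (ν * T) := by
    refine ⟨C, ?_⟩
    filter_upwards [hratev, self_mem_nhdsWithin] with s hs hsT x
    have hsT' : s < ν * T := hsT
    have hsq : 0 < Real.sqrt (ν * T - s) := Real.sqrt_pos.2 (sub_pos.2 hsT')
    rw [le_div_iff₀ hsq, mul_comm]
    exact hs x
  -- every point is a space–time Type-I centre of `v` (crux `FarFieldSlaving` at viscosity 1)
  have hslave := h₂ 1 (ν * T) one_pos hνT v π hclv hLHv hdecv hTIv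
  -- the zoom, and the dynamo Liouville theorem kills the limit
  obtain ⟨W, hW, hWm, hWd, t, ht, hWt⟩ :=
    hubbleDynamo_zoom_unit hC hνT hclv hLHv hdecv hratev hslave hextv
  exact hWt (h₁ W hW hWm hWd t ht)

end Summit.NavierStokesRegularity.NavierStokesRegularity.Theorems

end
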